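import Summits.QuantumFields.BalabanUV.T4Continuum.Support.UrsellTreeSum
import Summits.QuantumFields.BalabanUV.T4Continuum.Support.B13StepTermFamily

/-!
# NE5 ∕ U3 — convergence of the ORDERED series (2.13), part 2: the ANCHORED LEVEL BOUNDS of the Ursell series
# `Σ_{(Z₁,…,Z_N) ∋ q} |ρᵀ(Z₁,…,Z_N)|·Π w(Z_m) ≤ Φ^N ν^{N−1} (N−1)! 4^{N−1}` and their geometric majorant

Cell `pub-balaban`, unit `b2b-balaban-t4-ne5-formalise-leaf-08` (NE5 formalisation swarm, LEAF PROVER 08; row O1-d2 follower (iii),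
journal INTENT l.6289; part 1 = `Support/UrsellTreeSum.lean` p208810).  Summits-side NEW WORK under the LEAN PLACEMENT RULE (generic finite
combinatorics for the Ursell term family `B13StepTermFamily.term`∕`rhoT` of p207797).  HONEST FRAMING: rung (B)+1 of the FINITE-VOLUME
T⁴ continuum programme — NOT infinite volume, NOT a mass gap, NOT the Clay problem, NOT a proof of NE5.  HONEST DEPENDENCY (cell line,
verbatim): continuum YM on T⁴ ⇐ BetaPertH ∧ nine spine estimates (0/9 proved); BetaPertH ⇐ (D1) ∧ (D4) ∧ CAP+tail; G-an2-4 gates asym,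
D1 and NE2/3/4.

WHAT IS PROVED (the setting of part 1: finite polymer type `P`, footprints `cubes`, footprint-local symmetric hard core `inc` through
`reach` with `#reach ≤ ν·#cubes`, nonnegative majorant `w` with anchored exponential norm `Σ_{Z∋q} w(Z)e^{#cubes Z} ≤ Φ`):
* §1 `U p₀ cubes inc w S v q` = the ANCHORED URSELL LEVEL SUM `Σ_{Z⃗ pinned off S, q ∈ Z_v} |u_{g(Z⃗)}(S)|·Π_{u∈S} w(Z_u)` (`u` = the tree's
  hard-core Ursell coefficient `hcUrsell` of the tuple's incompatibility graph `g(Z⃗)`); `U_le_sum_W` — the TREE-GRAPH INEQUALITY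
  (`UrsellTreeGraphBound.abs_hcUrsell_le_card_treeGraphs`, BY NAME: *"|ρ^T(Y_1,…,Y_n)| ≤ number of tree graphs contained in g"*,
  Dimock RMP 25 (2013) App. B step 4) turns `U` into a sum of part 1's forest sums `W` over ALL rooted trees on `S`;
* §2 `sum_prod_factorial_children_le` — Cayley with prescribed degrees (`CayleyDegreeFormula.sum_trees_prod_factorial_le`, BY NAME:
  Dimock's (spit2) `Σ_τ Π_j (d_j − 1)! ≤ (n−2)! 4^{n−1}`) in child-count form `Σ_τ Π_u c_u! ≤ (n−1)!·4^{n−1}`; hence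
  **`U_le`**: `U ≤ Φ^{#S}·ν^{#S−1}·(#S−1)!·4^{#S−1}` (part 1's `W_le` summed over the trees);
* §3 THE ORDERED SERIES (2.13) OF [Balaban1988RG2Cluster] p. 14 (*"E^{(k+1)}(X) = Σ_{n=1}^∞ (1/n!) Σ_{(Z₁,…,Z_n): ∪Z_i = X}
  ρ^T(Z₁,…,Z_n)H(Z₁)…H(Z_n)"*, cited for FORM), level by level and anchored at a cube instead of localized at `X`:
  `sum_abs_rhoT_prod_le` (`Σ_{Z⃗ ∈ P^{N+1}, q ∈ Z_v} |ρᵀ(Z⃗)|·Π w ≤ Φ^{N+1}ν^N N! 4^N` for the generic `B13StepTermFamily.rhoT inc`),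
  `sum_abs_rhoT_prod_div_factorial_le` (÷(N+1)!: `≤ Φ·(4νΦ)^N`), and the geometric `levelMajorant` with `summable_levelMajorant` ∕
  `tsum_levelMajorant` (`= Φ/(1 − 4νΦ)` for `4νΦ < 1`): the printed *"sufficient conditions for convergence of the series (2.12), (2.13)
  … [26, 67, 25, 50]"* (p. 20) in the ordered form that `T4InputCauchyRateTermwise.TermRep`∕`TermBudget` consume.
NOT HERE (part 3): the localization at an output domain `X` (tuples COVERING `X`, the decay extraction of (2.27)∕(2.39)–(2.41), the
inner-label sums `H(Z) = Σ_j act Z j`) for `term (labelsIndexing G D) (touchInc G) act`.  The activity majorant itself ((2.38)'s shape)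
stays a displayed binder; nothing of the manuscripts under audit is asserted.  0 sorry; axioms ⊆ {propext, Classical.choice, Quot.sound}.
-/

noncomputable section

open Finset
open scoped BigOperators

namespace Summit.QuantumFields.BalabanUV.T4Continuum.UrsellSeriesBound

open Summit.QuantumFields.BalabanUV.T4Continuum.UrsellTreeSum
open Literature.Probability.LatticeModels (hcUrsell)
open Literature.Combinatorics.Enumerative (IsForestOn forests mem_forests children mem_children children_subset
  card_forests_mul_card)
open Literature.Combinatorics.Enumerative.CayleyDegreeFormula (degree degree_sub_one sum_trees_prod_factorial_le
  children_root_nonempty)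
open Literature.MathematicalPhysics.QuantumFieldTheory.Dimock2011to13.UrsellTreeGraphBound (treeGraphs mem_treeGraphs
  abs_hcUrsell_le_card_treeGraphs)

variable {ι P Q : Type*} [Fintype ι] [DecidableEq ι] [Fintype P] [DecidableEq Q]
variable (p₀ : P) (cubes reach : P → Finset Q) (inc : P → P → Prop) [DecidableRel inc] (w : P → ℝ) {ν Φ : ℝ}

/-! ## §1 The anchored Ursell level sum and the tree-graph inequality -/

/-- [folklore] THE ANCHORED URSELL LEVEL SUM on the active index set `S` with root `v` anchored at the cube `q`:
`Σ_{Z⃗ pinned off S} 𝟙[q ∈ cubes Z_v] · |u_{g(Z⃗)}(S)| · Π_{u∈S} w(Z_u)`, `g(Z⃗)` the tuple's incompatibility graph. -/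
def U (S : Finset ι) (v : ι) (q : Q) : ℝ :=
  ∑ Z ∈ pinned p₀ S, ind (q ∈ cubes (Z v)) * |(hcUrsell (fun i j => inc (Z i) (Z j)) S : ℝ)| * ∏ u ∈ S, w (Z u)

/-- [folklore] The number of tree graphs inside a graph, as a real sum of indicators over all rooted trees. -/
theorem card_treeGraphs_eq_sum (H : ι → ι → Prop) [DecidableRel H] (S : Finset ι) (v : ι) :
    ((treeGraphs H S v).card : ℝ) = ∑ τ ∈ forests S {v}, ind (∀ u ∈ S.erase v, H u (τ u)) := by
  rw [treeGraphs, card_filter]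
  push_cast
  exact sum_congr rfl fun τ _ => by unfold ind; split_ifs <;> simp

/-- [folklore] **THE TREE-GRAPH INEQUALITY APPLIED UNDER THE TUPLE SUM**: for a symmetric hard core and a nonnegative majorant,
`U(S, v, q) ≤ Σ_{τ ∈ rooted trees on S at v} W(S, {v}, τ, q)`. -/
theorem U_le_sum_W (hsymm : ∀ Z Z', inc Z Z' → inc Z' Z) (hw : ∀ Z, 0 ≤ w Z) {S : Finset ι} {v : ι} (hv : v ∈ S) (q : Q) :
    U p₀ cubes inc w S v q ≤ ∑ τ ∈ forests S {v}, W p₀ cubes inc w S {v} τ (fun _ => q) := by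
  unfold U W
  rw [sum_comm]
  refine sum_le_sum fun Z _ => ?_
  have h1 : |(hcUrsell (fun i j => inc (Z i) (Z j)) S : ℝ)| ≤ ((treeGraphs (fun i j => inc (Z i) (Z j)) S v).card : ℝ) := by
    exact_mod_cast abs_hcUrsell_le_card_treeGraphs (H := fun i j => inc (Z i) (Z j)) (fun i j h => hsymm _ _ h) S hv
  have htree : |(hcUrsell (fun i j => inc (Z i) (Z j)) S : ℝ)| ≤
      ∑ τ ∈ forests S {v}, ind (∀ u ∈ S.erase v, inc (Z u) (Z (τ u))) :=
    h1.trans (le_of_eq (card_treeGraphs_eq_sum (fun i j => inc (Z i) (Z j)) S v))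
  have h0 : 0 ≤ ind (q ∈ cubes (Z v)) * ∏ u ∈ S, w (Z u) := mul_nonneg (ind_nonneg _) (prod_nonneg fun _ _ => hw _)
  calc ind (q ∈ cubes (Z v)) * |(hcUrsell (fun i j => inc (Z i) (Z j)) S : ℝ)| * ∏ u ∈ S, w (Z u)
      = |(hcUrsell (fun i j => inc (Z i) (Z j)) S : ℝ)| * (ind (q ∈ cubes (Z v)) * ∏ u ∈ S, w (Z u)) := by ring
    _ ≤ (∑ τ ∈ forests S {v}, ind (∀ u ∈ S.erase v, inc (Z u) (Z (τ u)))) * (ind (q ∈ cubes (Z v)) * ∏ u ∈ S, w (Z u)) :=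
        mul_le_mul_of_nonneg_right htree h0
    _ = ∑ τ ∈ forests S {v}, (∏ r ∈ ({v} : Finset ι), ind ((fun _ : ι => q) r ∈ cubes (Z r))) *
          (∏ u ∈ S \ {v}, ind (inc (Z u) (Z (τ u)))) * ∏ u ∈ S, w (Z u) := by
        rw [sum_mul]
        refine sum_congr rfl fun τ _ => ?_
        rw [prod_singleton, sdiff_singleton_eq_erase]
        have : ind (∀ u ∈ S.erase v, inc (Z u) (Z (τ u))) = ∏ u ∈ S.erase v, ind (inc (Z u) (Z (τ u))) := by
          by_cases h : ∀ u ∈ S.erase v, inc (Z u) (Z (τ u))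
          · rw [ind_of_pos h]; exact (prod_eq_one fun u hu => ind_of_pos (h u hu)).symm
          · rw [ind_of_neg h]
            push Not at h
            obtain ⟨u, hu, hnot⟩ := h
            exact (prod_eq_zero hu (ind_of_neg hnot)).symm
        rw [this]
        ring

/-! ## §2 Cayley with prescribed degrees in child-count form; the anchored level bound -/

omit [Fintype P] [DecidableEq Q] in
/-- [folklore] **`Σ_τ Π_u c_u! ≤ (n−1)!·4^{n−1}`** over the rooted trees on an `n`-set `S` (root `v`), `c_u` the child counts — the
tree's Cayley-with-degrees bound `Σ_τ Π_u (d_u − 1)! ≤ (n−2)!·4^{n−1}` (`d_u − 1 = c_u` off the root, `c_v − 1` at the root, so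
`Π_u c_u! = c_v·Π_u (d_u − 1)! ≤ (n−1)·Π_u (d_u − 1)!`); for `n = 1` both sides are `1`. -/
theorem sum_prod_factorial_children_le {S : Finset ι} {v : ι} (hv : v ∈ S) :
    ∑ τ ∈ forests S {v}, ∏ u ∈ S, ((children S {v} u τ).card.factorial : ℝ) ≤
      ((S.card - 1).factorial : ℝ) * 4 ^ (S.card - 1) := by
  rcases Nat.lt_or_ge S.card 2 with h1 | h2
  · -- one vertex: the only tree is the identity, every child count is zero
    have hS : S = {v} := by
      have hc : S.card = 1 := by have := card_pos.2 ⟨v, hv⟩; omega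
      obtain ⟨a, ha⟩ := card_eq_one.1 hc
      rw [ha] at hv ⊢; rw [mem_singleton.1 hv]
    have hterm : ∀ τ ∈ forests S {v}, ∏ u ∈ S, ((children S {v} u τ).card.factorial : ℝ) = 1 := by
      intro τ _
      refine prod_eq_one fun u _ => ?_
      have : children S {v} u τ = ∅ := by
        rw [← subset_empty]; intro x hx
        have := children_subset (S := S) (R := {v}) (ρ := u) τ hx
        rw [hS, sdiff_self] at this
        exact this
      rw [this, card_empty, Nat.factorial_zero, Nat.cast_one]
    rw [sum_congr rfl hterm, sum_const, nsmul_eq_mul, mul_one]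
    have hcard : ((forests S {v}).card : ℝ) = 1 := by
      have h := card_forests_mul_card S {v} (singleton_subset_iff.2 hv)
      rw [hS, card_singleton] at h
      norm_num at h
      rw [hS]; exact_mod_cast h
    rw [hcard, hS, card_singleton]
    norm_num
  · have hcay := sum_trees_prod_factorial_le hv h2
    have hkey : ∀ τ ∈ forests S {v}, ∏ u ∈ S, ((children S {v} u τ).card.factorial : ℝ) ≤
        (S.card - 1 : ℕ) * ∏ u ∈ S, ((degree S v τ u - 1).factorial : ℝ) := by
      intro τ hτ
      rw [mem_forests] at hτ
      obtain ⟨u₀, hu₀S, hu₀v⟩ : ∃ u ∈ S, u ≠ v := by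
        by_contra h
        push Not at h
        have : S ⊆ {v} := fun u hu => mem_singleton.2 (h u hu)
        have := card_le_card this
        rw [card_singleton] at this
        omega
      have hcv : 1 ≤ (children S {v} v τ).card := card_pos.2 (children_root_nonempty hτ hv hu₀S hu₀v)
      have hcv' : (children S {v} v τ).card ≤ S.card - 1 := by
        have := card_le_card (children_subset (S := S) (R := {v}) (ρ := v) τ)
        rwa [card_sdiff_of_subset (singleton_subset_iff.2 hv), card_singleton] at this
      rw [← mul_prod_erase S _ hv, ← mul_prod_erase S (fun u => ((degree S v τ u - 1).factorial : ℝ)) hv]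
      have hrest : ∏ u ∈ S.erase v, ((children S {v} u τ).card.factorial : ℝ) =
          ∏ u ∈ S.erase v, ((degree S v τ u - 1).factorial : ℝ) :=
        prod_congr rfl fun u hu => by rw [degree_sub_one, if_neg (mem_erase.1 hu).1]
      rw [hrest, degree_sub_one, if_pos rfl, ← mul_assoc]
      refine mul_le_mul_of_nonneg_right ?_ (prod_nonneg fun _ _ => Nat.cast_nonneg _)
      have hfac : ((children S {v} v τ).card.factorial : ℝ) =
          (children S {v} v τ).card * (((children S {v} v τ).card - 1).factorial : ℝ) := by
        exact_mod_cast (Nat.mul_factorial_pred (by omega)).symm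
      rw [hfac]
      exact mul_le_mul_of_nonneg_right (by exact_mod_cast hcv') (Nat.cast_nonneg _)
    calc ∑ τ ∈ forests S {v}, ∏ u ∈ S, ((children S {v} u τ).card.factorial : ℝ)
        ≤ ∑ τ ∈ forests S {v}, (S.card - 1 : ℕ) * ∏ u ∈ S, ((degree S v τ u - 1).factorial : ℝ) := sum_le_sum hkey
      _ = (S.card - 1 : ℕ) * ((∑ τ ∈ forests S {v}, ∏ u ∈ S, (degree S v τ u - 1).factorial : ℕ) : ℝ) := by
          rw [← mul_sum]; push_cast; rfl
      _ ≤ (S.card - 1 : ℕ) * (((S.card - 2).factorial * 4 ^ (S.card - 1) : ℕ) : ℝ) :=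
          mul_le_mul_of_nonneg_left (by exact_mod_cast hcay) (Nat.cast_nonneg _)
      _ = ((S.card - 1).factorial : ℝ) * 4 ^ (S.card - 1) := by
          have : (S.card - 1) * (S.card - 2).factorial = (S.card - 1).factorial := by
            have h := Nat.mul_factorial_pred (n := S.card - 1) (by omega)
            rw [show S.card - 1 - 1 = S.card - 2 from by omega] at h
            exact h
          rw [← this]
          push_cast
          ring

/-- [folklore] **THE ANCHORED LEVEL BOUND** (part 1's `W_le` summed over the trees): `U(S, v, q) ≤ Φ^{#S}·ν^{#S−1}·(#S−1)!·4^{#S−1}`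
for a symmetric footprint-local hard core and a nonnegative majorant with anchored exponential norm `Φ`. -/
theorem U_le (hsymm : ∀ Z Z', inc Z Z' → inc Z' Z) (hloc : ∀ Z Z', inc Z' Z → ∃ q ∈ reach Z, q ∈ cubes Z') (hν : 0 ≤ ν)
    (hreach : ∀ Z, ((reach Z).card : ℝ) ≤ ν * (cubes Z).card) (hw : ∀ Z, 0 ≤ w Z) (hΦ0 : 0 ≤ Φ)
    (hΦ : ∀ q : Q, ∑ p : P, ind (q ∈ cubes p) * w p * Real.exp ((cubes p).card) ≤ Φ) {S : Finset ι} {v : ι} (hv : v ∈ S)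
    (q : Q) : U p₀ cubes inc w S v q ≤ Φ ^ S.card * ν ^ (S.card - 1) * (((S.card - 1).factorial : ℝ) * 4 ^ (S.card - 1)) := by
  refine (U_le_sum_W p₀ cubes inc w hsymm hw hv q).trans ?_
  calc ∑ τ ∈ forests S {v}, W p₀ cubes inc w S {v} τ (fun _ => q)
      ≤ ∑ τ ∈ forests S {v}, Φ ^ S.card * ν ^ (S.card - 1) * ∏ u ∈ S, ((children S {v} u τ).card.factorial : ℝ) := by
        refine sum_le_sum fun τ hτ => ?_
        have h := W_le p₀ cubes reach inc w hloc hν hreach hw hΦ S {v} τ (fun _ => q) (singleton_subset_iff.2 hv)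
          (mem_forests.1 hτ)
        rwa [card_singleton] at h
    _ = Φ ^ S.card * ν ^ (S.card - 1) * ∑ τ ∈ forests S {v}, ∏ u ∈ S, ((children S {v} u τ).card.factorial : ℝ) := by
        rw [mul_sum]
    _ ≤ Φ ^ S.card * ν ^ (S.card - 1) * (((S.card - 1).factorial : ℝ) * 4 ^ (S.card - 1)) :=
        mul_le_mul_of_nonneg_left (sum_prod_factorial_children_le hv) (mul_nonneg (pow_nonneg hΦ0 _) (pow_nonneg hν _))

/-! ## §3 The ordered series (2.13), anchored: level bounds for `B13StepTermFamily.rhoT` and the geometric majorant -/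

section Series

variable {N : ℕ}

/-- [folklore] On the full index set `Fin (N+1)` the anchored Ursell level sum is the plain sum over all tuples, with the generic
Ursell coefficient `B13StepTermFamily.rhoT inc` of p207797. -/
theorem U_univ_eq (v : Fin (N + 1)) (q : Q) :
    U p₀ cubes inc w (univ : Finset (Fin (N + 1))) v q =
      ∑ Z : Fin (N + 1) → P, ind (q ∈ cubes (Z v)) * |(B13StepTermFamily.rhoT inc Z : ℝ)| * ∏ m, w (Z m) := by
  unfold U B13StepTermFamily.rhoT
  rw [pinned_univ]

/-- [folklore] **LEVEL `N+1` OF THE ANCHORED ORDERED SERIES**: `Σ_{Z⃗ ∈ P^{N+1}, q ∈ Z_v} |ρᵀ(Z⃗)|·Π_m w(Z_m) ≤ Φ^{N+1}·ν^N·N!·4^N`. -/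
theorem sum_abs_rhoT_prod_le (hsymm : ∀ Z Z', inc Z Z' → inc Z' Z) (hloc : ∀ Z Z', inc Z' Z → ∃ q ∈ reach Z, q ∈ cubes Z')
    (hν : 0 ≤ ν) (hreach : ∀ Z, ((reach Z).card : ℝ) ≤ ν * (cubes Z).card) (hw : ∀ Z, 0 ≤ w Z) (hΦ0 : 0 ≤ Φ)
    (hΦ : ∀ q : Q, ∑ p : P, ind (q ∈ cubes p) * w p * Real.exp ((cubes p).card) ≤ Φ) (v : Fin (N + 1)) (q : Q) :
    ∑ Z : Fin (N + 1) → P, ind (q ∈ cubes (Z v)) * |(B13StepTermFamily.rhoT inc Z : ℝ)| * ∏ m, w (Z m) ≤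
      Φ ^ (N + 1) * ν ^ N * ((N.factorial : ℝ) * 4 ^ N) := by
  rcases isEmpty_or_nonempty P with hP | ⟨⟨p₀⟩⟩
  · rw [Finset.univ_eq_empty, sum_empty]; positivity
  · have h := U_le p₀ cubes reach inc w hsymm hloc hν hreach hw hΦ0 hΦ (mem_univ v) q
    rw [U_univ_eq, card_univ, Fintype.card_fin, Nat.add_sub_cancel] at h
    exact h

/-- [folklore] THE GEOMETRIC LEVEL MAJORANT `Φ·(4νΦ)^N` of the anchored ordered series after division by `(N+1)!`. -/
def levelMajorant (ν Φ : ℝ) (N : ℕ) : ℝ := Φ * (4 * ν * Φ) ^ N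

/-- [folklore] **THE `1/(N+1)!`-NORMALISED LEVEL BOUND**: `(1/(N+1)!)·Σ_{Z⃗, q ∈ Z_v} |ρᵀ(Z⃗)|·Π w ≤ Φ·(4νΦ)^N` (indeed `≤ ·/(N+1)`). -/
theorem sum_abs_rhoT_prod_div_factorial_le (hsymm : ∀ Z Z', inc Z Z' → inc Z' Z)
    (hloc : ∀ Z Z', inc Z' Z → ∃ q ∈ reach Z, q ∈ cubes Z') (hν : 0 ≤ ν)
    (hreach : ∀ Z, ((reach Z).card : ℝ) ≤ ν * (cubes Z).card) (hw : ∀ Z, 0 ≤ w Z) (hΦ0 : 0 ≤ Φ)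
    (hΦ : ∀ q : Q, ∑ p : P, ind (q ∈ cubes p) * w p * Real.exp ((cubes p).card) ≤ Φ) (v : Fin (N + 1)) (q : Q) :
    (∑ Z : Fin (N + 1) → P, ind (q ∈ cubes (Z v)) * |(B13StepTermFamily.rhoT inc Z : ℝ)| * ∏ m, w (Z m)) /
        ((N + 1).factorial : ℝ) ≤ levelMajorant ν Φ N := by
  have hfac : (0 : ℝ) < (N + 1).factorial := by exact_mod_cast Nat.factorial_pos _
  rw [div_le_iff₀ hfac, levelMajorant]
  refine (sum_abs_rhoT_prod_le cubes reach inc w hsymm hloc hν hreach hw hΦ0 hΦ v q).trans ?_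
  have hN : (N.factorial : ℝ) ≤ (N + 1).factorial := by exact_mod_cast Nat.factorial_le (Nat.le_succ N)
  have h4 : (0 : ℝ) ≤ (4 * ν * Φ) ^ N := pow_nonneg (by positivity) _
  calc Φ ^ (N + 1) * ν ^ N * ((N.factorial : ℝ) * 4 ^ N) = Φ * (4 * ν * Φ) ^ N * N.factorial := by ring
    _ ≤ Φ * (4 * ν * Φ) ^ N * (N + 1).factorial := mul_le_mul_of_nonneg_left hN (mul_nonneg hΦ0 h4)

omit [Fintype ι] [DecidableEq ι] [Fintype P] [DecidableEq Q] in
/-- [folklore] The level majorants are nonnegative. -/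
theorem levelMajorant_nonneg (hν : 0 ≤ ν) (hΦ0 : 0 ≤ Φ) (N : ℕ) : 0 ≤ levelMajorant ν Φ N :=
  mul_nonneg hΦ0 (pow_nonneg (by positivity) N)

omit [Fintype ι] [DecidableEq ι] [Fintype P] [DecidableEq Q] in
/-- [folklore] **SUMMABILITY OF THE LEVEL MAJORANTS** for `4νΦ < 1` (the printed *"sufficient conditions for convergence of the series
(2.12), (2.13)"*, p. 20 of [II], in the ordered form: a SMALLNESS of the anchored exponential activity norm). -/
theorem summable_levelMajorant (hν : 0 ≤ ν) (hΦ0 : 0 ≤ Φ) (hsmall : 4 * ν * Φ < 1) : Summable (levelMajorant ν Φ) :=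
  (summable_geometric_of_lt_one (by positivity) hsmall).mul_left Φ

omit [Fintype ι] [DecidableEq ι] [Fintype P] [DecidableEq Q] in
/-- [folklore] The sum of the level majorants: `Σ_N Φ·(4νΦ)^N = Φ/(1 − 4νΦ)`. -/
theorem tsum_levelMajorant (hν : 0 ≤ ν) (hΦ0 : 0 ≤ Φ) (hsmall : 4 * ν * Φ < 1) :
    ∑' N, levelMajorant ν Φ N = Φ / (1 - 4 * ν * Φ) := by
  unfold levelMajorant
  rw [tsum_mul_left, tsum_geometric_of_lt_one (by positivity) hsmall, div_eq_mul_inv]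

end Series

end Summit.QuantumFields.BalabanUV.T4Continuum.UrsellSeriesBound

end
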